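import Literature.Geometry.Lorentzian.KerrRadiusGradientVector
import Literature.Geometry.Lorentzian.KerrSchildTimeTranslation
import Literature.Geometry.Lorentzian.KerrCylinderParameterCloseness
import Literature.Geometry.Lorentzian.KerrConvergenceProofs
import Literature.Analysis.Calculus.ParametricIteratedFDeriv
import HarnessLib

/-!
# `KerrBandHigherRegularityUniform`: tube radius, non-characteristic lower bound for `dr` and
# all-order bounds of the Kerr–Schild data around a radial band, UNIFORMLY over a compact set
# of subextremal labels
(crux `GapExhaustion`, stmt-FinalStateConjecture-10808, line photon-shell-pseudoconvexity;
stub (UN-2) `stub_kerrBandHigherRegularityU`, the label-uniform twin of the per-label brick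
`stub_kerrBandHigherRegularity` of `BartnikGapSettlingGapExhaustionKerrBandHigherRegularity.lean`;
lead c11, label-uniformity wave 1)

The registered outward Killing sweep S5 quantifies its constants BEFORE the Kerr label `(M, a)`,
over a compact window of subextremal labels. The per-label exact-Kerr bookkeeping brick of the
reduction of S5 to the Ionescu–Klainerman local extension theorem therefore has to hold with ONE
set of constants for all labels `ℓ = (M, a)` of a compact set `K ⊆ {0 < M, |a| < M}` and all bands
`r_lo(ℓ) ≤ r ≤ r_hi(ℓ)`, `r₊(ℓ) < r_lo(ℓ)`, with `r_lo`, `r_hi` continuous on `K`: there are a tube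
radius `ρ₀ > 0`, a Lipschitz constant `L₃ ≥ 0`, a lower bound `ν > 0` and one constant `C ≥ 0`
such that for every `ℓ ∈ K`, every point `z` of Kerr–Schild coordinate space with
`r_lo(ℓ) ≤ r_{a}(z) ≤ r_hi(ℓ)` (all Kerr-star times) and every `w` with `‖w‖ ≤ ρ₀`

* `r_a(z + w) > (r₊(ℓ) + r_lo(ℓ))/2` (so `g_{M,a}` and `r_a` are `C^∞` at `z + w`),
* `|r_a(z + w) − r_a(z)| ≤ L₃ ‖w‖`,
* `‖Dr_a(z + w)‖ ≥ ν`,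
* `‖Dʲ g_{M,a}(z + w)‖ ≤ C` and `‖Dʲ r_a(z + w)‖ ≤ C` for all `j ≤ n`.

Proof: the per-label compactness argument run over the compact LABELLED time slice
`S = {(ℓ, z) | ℓ ∈ K, z⁰ = 0, r_lo(ℓ) ≤ r_{ℓ.2}(z) ≤ r_hi(ℓ)} ⊆ (ℝ × ℝ) × E4` (closed since `K` is
closed, `r_lo`, `r_hi` are continuous on `K` and the Kerr–Schild radius is jointly continuous in
`(a, x)`; bounded by `‖x⃗‖² ≤ r² + a²`). The set `{(ℓ, x) | ℓ ∈ K, r_{ℓ.2}(x) ≤ (r₊ + r_lo)(ℓ)/2}`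
is closed and disjoint from `S`, so a closed thickening `cthickening ρ₀ S` misses it
(`IsCompact.exists_cthickening_subset_open`); the compact labelled tube
`T = cthickening ρ₀ S ∩ (K × E4)` lies in `{r > (r₊ + r_lo)/2} ⊆ {r > 0}`, where the family
`(M, a, x) ↦ g_{M,a}(x)` and the radius `(a, x) ↦ r_a(x)` are jointly smooth
(`Kerr.contDiffAt_bilin₃`, `Kerr.contDiffAt_radius₂`), hence so are all their iterated
`x`-derivatives as functions of `(ℓ, x)`
(`Literature.Analysis.Calculus.contDiffAt_iteratedFDeriv_parametric`); whence the bounds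
(`IsCompact.exists_bound_of_continuousOn`) and the positive minimum of `‖Dr‖`
(`IsCompact.exists_isMinOn`; `dr ≠ 0` beyond `r₊` since `dr(♯dr) = Δ/Σ > 0`). A band point at any
time is translated to the slice by stationarity of Kerr–Schild
(`Kerr.radius_add_time_smul_basisVector`, `Kerr.bilin_add_time`), and the Lipschitz bound is the
mean value inequality on the ball `closedBall z ρ₀`, which stays in the tube.

References: R. P. Kerr, A. Schild (1965), §§2–3 [KerrSchild1965]; M. Visser, arXiv:0706.0622,
(32)–(35) [arXiv07060622]; B. O'Neill, *The geometry of Kerr black holes* (1995), §2.5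
[ONeill1995]; J. Dieudonné, *Foundations of Modern Analysis* (1960), (8.5.4), (8.12.6);
A. D. Ionescu, S. Klainerman, Invent. Math. 175 (2009), Def. 3.1.
-/

noncomputable section

-- instance search through the nested operator types `E4 →L[ℝ] E4 →L[ℝ] E4 →L[ℝ] ℝ`
set_option maxSynthPendingDepth 3

-- D-0017: single-problem summit, `Summit.<S>.<S>.…` by design (cf. lakefile `weak.linter.dupNamespace`).
set_option linter.dupNamespace false

namespace Summit.FinalStateConjecture.FinalStateConjecture.Theorems

open Set Literature.Geometry.Lorentzian
open scoped Manifold ContDiff Topology ENNReal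

/-- Translation invariance of a function passes to all its iterated derivatives:
if `f (x + v) = f x` for all `x`, then `Dʲf (x + v) = Dʲf x` (Mathlib's
`iteratedFDeriv_comp_add_right`). [folklore] -/
theorem stub_kerrBandHigherRegularityU_iteratedFDeriv_eq_of_forall_add_eq {F : Type*}
    [NormedAddCommGroup F] [NormedSpace ℝ F] {f : E4 → F} {v : E4} (h : ∀ x, f (x + v) = f x)
    (j : ℕ) (x : E4) : iteratedFDeriv ℝ j f (x + v) = iteratedFDeriv ℝ j f x := by
  rw [← iteratedFDeriv_comp_add_right j v x, show (fun z ↦ f (z + v)) = f from funext h]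

/-- Beyond the event horizon of a subextremal Kerr the differential of the Kerr–Schild radius
does not vanish: `dr(W) = g(W, W) = Δ(r)/Σ > 0` for the metric gradient `W = ♯dr`
(`Kerr.radiusGradVector`), `Δ(r) = (r − r₊)(r − r₋) > 0` for `r > r₊`. O'Neill 1995, §2.5.
[cite: ONeill1995, §2.5] -/
theorem stub_kerrBandHigherRegularityU_fderiv_radius_ne_zero {M a : ℝ} (ha : |a| < M) {z : E4}
    (hz : Kerr.rPlus M a < Kerr.radius a z) : fderiv ℝ (Kerr.radius a) z ≠ 0 := by
  have hsub : Kerr.IsSubextremal M a := ha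
  have hz0 : 0 < Kerr.radius a z := hsub.rPlus_pos.trans hz
  have hpos : 0 < fderiv ℝ (Kerr.radius a) z (Kerr.radiusGradVector M a z) := by
    rw [(Kerr.hasFDerivAt_radius_bilin (M := M) hz0).fderiv, Kerr.bilin_radiusGradVector_self hz0]
    refine div_pos ?_ (Kerr.blSigma_spatial_pos hz0)
    rw [← Kerr.sub_rPlus_mul_sub_rMinus hsub.sq_lt_sq.le]
    exact Kerr.sub_rPlus_mul_sub_rMinus_pos hz
  intro h
  rw [h] at hpos
  simp at hpos

/-- The Kerr–Schild radius `r_a(x)` is jointly continuous in the label `ℓ = (M, a)` and the point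
`x` (it depends on `(a, x)` only, through an explicit composition of polynomials and square roots;
Visser arXiv:0706.0622, (35)). [cite: KerrSchild1965, §3] -/
theorem stub_kerrBandHigherRegularityU_continuous_radius :
    Continuous fun q : (ℝ × ℝ) × E4 ↦ Kerr.radius q.1.2 q.2 := by
  unfold Kerr.radius E4.spatialNorm
  fun_prop

/-- On the time slice `{x⁰ = 0}`: `‖x‖² = ‖x⃗‖² ≤ r_a(x)² + a²` (from
`r² = ((ρ² − a²) + √((ρ² − a²)² + 4a²z²))/2 ≥ ρ² − a²`; Visser arXiv:0706.0622, (35)).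
[cite: KerrSchild1965, §3] -/
theorem stub_kerrBandHigherRegularityU_norm_sq_le {a : ℝ} {x : E4} (hx0 : x 0 = 0) :
    ‖x‖ ^ 2 ≤ Kerr.radius a x ^ 2 + a ^ 2 := by
  have h1 : ‖x‖ ^ 2 = E4.spatialNorm x ^ 2 := by
    rw [EuclideanSpace.real_norm_sq_eq, Fin.sum_univ_four, hx0, E4.spatialNorm_sq]
    ring
  have h2 : E4.spatialNorm x ^ 2 - a ^ 2 ≤ Kerr.radius a x ^ 2 := by
    rw [Kerr.radius_sq]
    linarith [Kerr.abs_le_sqrt_radius_discr a x, le_abs_self (E4.spatialNorm x ^ 2 - a ^ 2)]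
  linarith

/-- **(UN-2) All-order regularity of exact Kerr on a tube around a radial band, uniformly over a
compact set of subextremal labels (crux `GapExhaustion`, stmt-FinalStateConjecture-10808; line
photon-shell-pseudoconvexity, reduction of the outward sweep S5 to the Ionescu–Klainerman local
extension theorem, label-uniform form).** For a compact `K ⊆ {(M, a) | 0 < M, |a| < M}`, band
radii `r_lo r_hi` continuous on `K` with `r₊(ℓ) < r_lo(ℓ) ≤ r_hi(ℓ)` and an order `n` there are
`ρ₀ > 0`, `L₃ ≥ 0`, `ν > 0`, `C ≥ 0` such that for every `ℓ = (M, a) ∈ K`, every `z` with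
`r_lo(ℓ) ≤ r_a(z) ≤ r_hi(ℓ)` (all times) and every `‖w‖ ≤ ρ₀`: `r_a(z + w) > (r₊(ℓ) + r_lo(ℓ))/2`,
`|r_a(z + w) − r_a(z)| ≤ L₃‖w‖`, `g_{M,a}` and `r_a` are `C^∞` at `z + w`, `‖Dr_a(z + w)‖ ≥ ν`, and
`‖Dʲ g_{M,a}(z + w)‖ ≤ C`, `‖Dʲ r_a(z + w)‖ ≤ C` for `j ≤ n`. Compactness of the closed thickening
of the labelled time slice of the bands, joint smoothness of the Kerr–Schild family in `(M, a, x)`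
on `{r > 0}` (Kerr–Schild 1965, §3; Visser arXiv:0706.0622, (32)–(35)), `dr(♯dr) = Δ/Σ > 0`
beyond `r₊` (O'Neill 1995, §2.5), stationarity of Kerr, and the mean value inequality.
[cite: KerrSchild1965, §3] -/
theorem stub_kerrBandHigherRegularityU :
    ∀ (K : Set (ℝ × ℝ)) (r_lo r_hi : ℝ × ℝ → ℝ) (n : ℕ), IsCompact K →
      (∀ ℓ ∈ K, 0 < ℓ.1 ∧ |ℓ.2| < ℓ.1) → ContinuousOn r_lo K → ContinuousOn r_hi K →
      (∀ ℓ ∈ K, Kerr.rPlus ℓ.1 ℓ.2 < r_lo ℓ ∧ r_lo ℓ ≤ r_hi ℓ) →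
      ∃ (ρ₀ L₃ ν C : ℝ), 0 < ρ₀ ∧ 0 ≤ L₃ ∧ 0 < ν ∧ 0 ≤ C ∧
      ∀ ℓ ∈ K, ∀ z : E4, r_lo ℓ ≤ Kerr.radius ℓ.2 z → Kerr.radius ℓ.2 z ≤ r_hi ℓ →
        ∀ w : E4, ‖w‖ ≤ ρ₀ →
        (Kerr.rPlus ℓ.1 ℓ.2 + r_lo ℓ) / 2 < Kerr.radius ℓ.2 (z + w) ∧
        |Kerr.radius ℓ.2 (z + w) - Kerr.radius ℓ.2 z| ≤ L₃ * ‖w‖ ∧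
        ContDiffAt ℝ ∞ (Kerr.bilin ℓ.1 ℓ.2) (z + w) ∧ ContDiffAt ℝ ∞ (Kerr.radius ℓ.2) (z + w) ∧
        ν ≤ ‖fderiv ℝ (Kerr.radius ℓ.2) (z + w)‖ ∧
        ∀ j : ℕ, j ≤ n →
          ‖iteratedFDeriv ℝ j (Kerr.bilin ℓ.1 ℓ.2) (z + w)‖ ≤ C ∧
          ‖iteratedFDeriv ℝ j (Kerr.radius ℓ.2) (z + w)‖ ≤ C := by
  intro K r_lo r_hi n hK hKsub hloc hhic hband
  -- positivity of the horizon radius of every label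
  have hrp : ∀ ℓ ∈ K, 0 < Kerr.rPlus ℓ.1 ℓ.2 := fun ℓ hℓ ↦
    Kerr.IsSubextremal.rPlus_pos (M := ℓ.1) (a := ℓ.2) (hKsub ℓ hℓ).2
  -- the threshold radius `r₁(ℓ) = (r₊(ℓ) + r_lo(ℓ))/2`, strictly between `r₊(ℓ)` and `r_lo(ℓ)`
  set r₁ : ℝ × ℝ → ℝ := fun ℓ ↦ (Kerr.rPlus ℓ.1 ℓ.2 + r_lo ℓ) / 2 with hr₁
  have hr₁p : ∀ ℓ ∈ K, Kerr.rPlus ℓ.1 ℓ.2 < r₁ ℓ := fun ℓ hℓ ↦ by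
    have h := (hband ℓ hℓ).1
    simp only [hr₁]
    linarith
  have hr₁lo : ∀ ℓ ∈ K, r₁ ℓ < r_lo ℓ := fun ℓ hℓ ↦ by
    have h := (hband ℓ hℓ).1
    simp only [hr₁]
    linarith
  have hr₁0 : ∀ ℓ ∈ K, 0 < r₁ ℓ := fun ℓ hℓ ↦ (hrp ℓ hℓ).trans (hr₁p ℓ hℓ)
  -- continuity: `r₊` is continuous, `r₁` is continuous on `K`, the radius is jointly continuous
  have hrPc : Continuous fun ℓ : ℝ × ℝ ↦ Kerr.rPlus ℓ.1 ℓ.2 := by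
    unfold Kerr.rPlus
    fun_prop
  have hr₁c : ContinuousOn r₁ K := (hrPc.continuousOn.add hloc).div_const 2
  have hradc : Continuous fun q : (ℝ × ℝ) × E4 ↦ Kerr.radius q.1.2 q.2 :=
    stub_kerrBandHigherRegularityU_continuous_radius
  -- the closed set `S₀ = K × E4` of labelled points
  set S₀ : Set ((ℝ × ℝ) × E4) := {q | q.1 ∈ K} with hS₀def
  have hS₀ : IsClosed S₀ := hK.isClosed.preimage continuous_fst
  have hloS₀ : ContinuousOn (fun q : (ℝ × ℝ) × E4 ↦ r_lo q.1) S₀ :=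
    hloc.comp continuous_fst.continuousOn fun q hq ↦ hq
  have hhiS₀ : ContinuousOn (fun q : (ℝ × ℝ) × E4 ↦ r_hi q.1) S₀ :=
    hhic.comp continuous_fst.continuousOn fun q hq ↦ hq
  have hr₁S₀ : ContinuousOn (fun q : (ℝ × ℝ) × E4 ↦ r₁ q.1) S₀ :=
    hr₁c.comp continuous_fst.continuousOn fun q hq ↦ hq
  -- the compact labelled time slice of the bands
  set S : Set ((ℝ × ℝ) × E4) := {q | q.1 ∈ K ∧ q.2 0 = 0 ∧ r_lo q.1 ≤ Kerr.radius q.1.2 q.2 ∧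
    Kerr.radius q.1.2 q.2 ≤ r_hi q.1} with hSdef
  have hSclosed : IsClosed S := by
    have h0 : IsClosed {q : (ℝ × ℝ) × E4 | q.2 0 = 0} :=
      isClosed_eq ((E4.dx 0).continuous.comp continuous_snd) continuous_const
    have h1 : IsClosed {q ∈ S₀ | r_lo q.1 ≤ Kerr.radius q.1.2 q.2} :=
      hS₀.isClosed_le hloS₀ hradc.continuousOn
    have h2 : IsClosed {q ∈ S₀ | Kerr.radius q.1.2 q.2 ≤ r_hi q.1} :=
      hS₀.isClosed_le hradc.continuousOn hhiS₀
    have hSeq : S = {q : (ℝ × ℝ) × E4 | q.2 0 = 0} ∩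
        ({q ∈ S₀ | r_lo q.1 ≤ Kerr.radius q.1.2 q.2} ∩
          {q ∈ S₀ | Kerr.radius q.1.2 q.2 ≤ r_hi q.1}) := by
      ext q
      simp only [hSdef, hS₀def, mem_setOf_eq, mem_inter_iff]
      tauto
    rw [hSeq]
    exact h0.inter (h1.inter h2)
  obtain ⟨B₁, hB₁⟩ := hK.exists_bound_of_continuousOn hhic
  obtain ⟨B₂, hB₂⟩ := hK.isBounded.exists_norm_le
  have hS : IsCompact S := by
    refine (hK.prod (isCompact_closedBall (0 : E4) (|B₁| + |B₂|))).of_isClosed_subset hSclosed ?_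
    intro q hq
    obtain ⟨hℓ, hx0, -, hxhi⟩ := hq
    refine mk_mem_prod hℓ (mem_closedBall_zero_iff.2 ?_)
    have h1 := stub_kerrBandHigherRegularityU_norm_sq_le (a := q.1.2) hx0
    have h2 : Kerr.radius q.1.2 q.2 ≤ |B₁| :=
      (hxhi.trans (Real.le_norm_self _)).trans ((hB₁ q.1 hℓ).trans (le_abs_self _))
    have h3 : |q.1.2| ≤ |B₂| :=
      ((Real.norm_eq_abs _).symm.le.trans (norm_snd_le q.1)).trans
        ((hB₂ q.1 hℓ).trans (le_abs_self _))
    have h4 : Kerr.radius q.1.2 q.2 ^ 2 ≤ |B₁| ^ 2 :=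
      pow_le_pow_left₀ (Kerr.radius_nonneg _ _) h2 2
    have h5 : q.1.2 ^ 2 ≤ |B₂| ^ 2 := by
      rw [← sq_abs q.1.2]
      exact pow_le_pow_left₀ (abs_nonneg _) h3 2
    have h6 : ‖q.2‖ ^ 2 ≤ (|B₁| + |B₂|) ^ 2 := by nlinarith [abs_nonneg B₁, abs_nonneg B₂]
    exact (sq_le_sq₀ (norm_nonneg _) (by positivity)).1 h6
  -- every point of `S` has radius `> r₁`: a closed thickening of `S` misses the closed set
  -- `{(ℓ, x) | ℓ ∈ K, r(x) ≤ r₁(ℓ)}`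
  have hZ : IsClosed {q ∈ S₀ | Kerr.radius q.1.2 q.2 ≤ r₁ q.1} :=
    hS₀.isClosed_le hradc.continuousOn hr₁S₀
  set O : Set ((ℝ × ℝ) × E4) := {q ∈ S₀ | Kerr.radius q.1.2 q.2 ≤ r₁ q.1}ᶜ with hOdef
  have hO : IsOpen O := hZ.isOpen_compl
  have hSO : S ⊆ O := fun q hq hqZ ↦
    lt_irrefl (r₁ q.1) ((hr₁lo q.1 hq.1).trans_le (hq.2.2.1.trans hqZ.2))
  obtain ⟨ρ₀, hρ₀, hρ₀O⟩ := hS.exists_cthickening_subset_open hO hSO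
  -- the compact labelled tube `T = cthickening ρ₀ S ∩ (K × E4) ⊆ {r > r₁} ⊆ {r > 0}`
  set T : Set ((ℝ × ℝ) × E4) := Metric.cthickening ρ₀ S ∩ S₀ with hTdef
  have hT : IsCompact T := hS.cthickening.inter_right hS₀
  have hTr₁ : ∀ x ∈ T, r₁ x.1 < Kerr.radius x.1.2 x.2 := fun x hx ↦ by
    by_contra h
    have hxO : x ∉ {q ∈ S₀ | Kerr.radius q.1.2 q.2 ≤ r₁ q.1} := hρ₀O hx.1
    exact hxO ⟨hx.2, not_lt.1 h⟩
  have hTpos : ∀ x ∈ T, 0 < Kerr.radius x.1.2 x.2 := fun x hx ↦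
    (hr₁0 x.1 hx.2).trans (hTr₁ x hx)
  -- the translates `(ℓ, z + w)`, `‖w‖ ≤ ρ₀`, of the points `(ℓ, z)` of the slice lie in the tube
  have hmemT : ∀ q ∈ S, ∀ w : E4, ‖w‖ ≤ ρ₀ → (q.1, q.2 + w) ∈ T := fun q hq w hw ↦ by
    refine ⟨Metric.mem_cthickening_of_dist_le _ q ρ₀ S hq ?_, hq.1⟩
    rw [Prod.dist_eq]
    refine max_le ?_ ?_
    · show dist q.1 q.1 ≤ ρ₀
      rw [dist_self]
      exact hρ₀.le
    · show dist (q.2 + w) q.2 ≤ ρ₀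
      rwa [dist_eq_norm, add_sub_cancel_left]
  -- joint smoothness on `{r > 0}` of the Kerr–Schild family and of the radius, in `(ℓ, x)`
  have hFb : ∀ q ∈ {q : (ℝ × ℝ) × E4 | 0 < Kerr.radius q.1.2 q.2},
      ContDiffAt ℝ ∞ (fun q : (ℝ × ℝ) × E4 ↦ Kerr.bilin q.1.1 q.1.2 q.2) q := fun q hq ↦ by
    have h := (Kerr.contDiffAt_bilin₃ (n := ∞) (q := (q.1.1, q.1.2, q.2)) hq).comp q
      (contDiffAt_fst.fst.prodMk (contDiffAt_fst.snd.prodMk contDiffAt_snd))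
    exact h
  have hFr : ∀ q ∈ {q : (ℝ × ℝ) × E4 | 0 < Kerr.radius q.1.2 q.2},
      ContDiffAt ℝ ∞ (fun q : (ℝ × ℝ) × E4 ↦ Kerr.radius q.1.2 q.2) q := fun q hq ↦ by
    have h := (Kerr.contDiffAt_radius₂ (n := ∞) (p := (q.1.2, q.2)) hq).comp q
      (contDiffAt_fst.snd.prodMk contDiffAt_snd)
    exact h
  -- continuity on the tube of all the iterated derivatives of `g_{M,a}` and `r`, and of `‖Dr‖`
  have hcb : ∀ j : ℕ, ContinuousOn
      (fun x : (ℝ × ℝ) × E4 ↦ iteratedFDeriv ℝ j (Kerr.bilin x.1.1 x.1.2) x.2) T :=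
    fun j x hx ↦ (Literature.Analysis.Calculus.contDiffAt_iteratedFDeriv_parametric hFb j x
      (hTpos x hx)).continuousAt.continuousWithinAt
  have hcr : ∀ j : ℕ, ContinuousOn
      (fun x : (ℝ × ℝ) × E4 ↦ iteratedFDeriv ℝ j (Kerr.radius x.1.2) x.2) T :=
    fun j x hx ↦ (Literature.Analysis.Calculus.contDiffAt_iteratedFDeriv_parametric hFr j x
      (hTpos x hx)).continuousAt.continuousWithinAt
  have hc₃ : ContinuousOn (fun x : (ℝ × ℝ) × E4 ↦ ‖fderiv ℝ (Kerr.radius x.1.2) x.2‖) T := by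
    have h := (hcr 1).norm
    simp only [norm_iteratedFDeriv_one] at h
    exact h
  -- the bound of `Dr` (the Lipschitz constant of `r`)
  obtain ⟨C₃, hC₃⟩ := hT.exists_bound_of_continuousOn hc₃
  -- one bound for all the derivatives of order `≤ n`, through the continuous sum of their norms
  set Φ : (ℝ × ℝ) × E4 → ℝ := fun x ↦ ∑ j ∈ Finset.range (n + 1),
    (‖iteratedFDeriv ℝ j (Kerr.bilin x.1.1 x.1.2) x.2‖ +
      ‖iteratedFDeriv ℝ j (Kerr.radius x.1.2) x.2‖) with hΦ
  have hΦc : ContinuousOn Φ T :=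
    continuousOn_finsetSum _ fun j _ ↦ (hcb j).norm.add (hcr j).norm
  obtain ⟨C, hC⟩ := hT.exists_bound_of_continuousOn hΦc
  have hΦle : ∀ x ∈ T, ∀ j : ℕ, j ≤ n →
      ‖iteratedFDeriv ℝ j (Kerr.bilin x.1.1 x.1.2) x.2‖ ≤ max C 0 ∧
      ‖iteratedFDeriv ℝ j (Kerr.radius x.1.2) x.2‖ ≤ max C 0 := by
    intro x hx j hj
    have hjmem : j ∈ Finset.range (n + 1) := Finset.mem_range.2 (Nat.lt_succ_of_le hj)
    have hsum : ‖iteratedFDeriv ℝ j (Kerr.bilin x.1.1 x.1.2) x.2‖ +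
        ‖iteratedFDeriv ℝ j (Kerr.radius x.1.2) x.2‖ ≤ Φ x :=
      Finset.single_le_sum (f := fun j ↦ ‖iteratedFDeriv ℝ j (Kerr.bilin x.1.1 x.1.2) x.2‖ +
          ‖iteratedFDeriv ℝ j (Kerr.radius x.1.2) x.2‖)
        (fun i _ ↦ add_nonneg (norm_nonneg _) (norm_nonneg _)) hjmem
    have hΦC : Φ x ≤ max C 0 := (Real.le_norm_self _).trans ((hC x hx).trans (le_max_left _ _))
    exact ⟨(le_add_of_nonneg_right (norm_nonneg _)).trans (hsum.trans hΦC),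
      (le_add_of_nonneg_left (norm_nonneg _)).trans (hsum.trans hΦC)⟩
  -- the positive lower bound of `‖Dr‖` on the tube (`Dr ≠ 0` beyond `r₊`)
  obtain ⟨ν, hν, hνT⟩ : ∃ ν : ℝ, 0 < ν ∧ ∀ x ∈ T, ν ≤ ‖fderiv ℝ (Kerr.radius x.1.2) x.2‖ := by
    by_cases hne : T.Nonempty
    · obtain ⟨x₀, hx₀, hmin⟩ := hT.exists_isMinOn hne hc₃
      exact ⟨‖fderiv ℝ (Kerr.radius x₀.1.2) x₀.2‖,
        norm_pos_iff.2 (stub_kerrBandHigherRegularityU_fderiv_radius_ne_zero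
          (hKsub x₀.1 hx₀.2).2 ((hr₁p x₀.1 hx₀.2).trans (hTr₁ x₀ hx₀))),
        fun x hx ↦ hmin hx⟩
    · exact ⟨1, one_pos, fun x hx ↦ absurd ⟨x, hx⟩ hne⟩
  refine ⟨ρ₀, max C₃ 0, ν, max C 0, hρ₀, le_max_right _ _, hν, le_max_right _ _, ?_⟩
  intro ℓ hℓ z hzlo hzhi
  -- translate `z` to the time slice: `z = z' + t ∂₀`, `t = z⁰`
  set t : ℝ := z 0 with ht
  set z' : E4 := z + (-t) • E4.basisVector 0 with hz'
  have hzz' : ∀ w : E4, z + w = (z' + w) + t • E4.basisVector 0 := fun w ↦ by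
    rw [hz', neg_smul]; abel
  have hz'0 : z' 0 = 0 := by simp [hz', ht, E4.basisVector]
  have hrad' : Kerr.radius ℓ.2 z' = Kerr.radius ℓ.2 z :=
    Kerr.radius_add_time_smul_basisVector ℓ.2 z (-t)
  clear_value t z'
  have hzlo' : r_lo ℓ ≤ Kerr.radius ℓ.2 z' := by rw [hrad']; exact hzlo
  have hzhi' : Kerr.radius ℓ.2 z' ≤ r_hi ℓ := by rw [hrad']; exact hzhi
  have hz'S : (ℓ, z') ∈ S := ⟨hℓ, hz'0, hzlo', hzhi'⟩
  -- the points `(ℓ, z' + w)`, `‖w‖ ≤ ρ₀`, lie in the tube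
  have hmemT' : ∀ w : E4, ‖w‖ ≤ ρ₀ → (ℓ, z' + w) ∈ T := fun w hw ↦ hmemT (ℓ, z') hz'S w hw
  -- stationarity of Kerr: the radius, its derivative and all the iterated derivatives of the
  -- components and of the radius at `z + w` are those at `z' + w`
  have hradd : ∀ x : E4, Kerr.radius ℓ.2 (x + t • E4.basisVector 0) = Kerr.radius ℓ.2 x :=
    fun x ↦ Kerr.radius_add_time_smul_basisVector ℓ.2 x t
  have hradT : ∀ w : E4, Kerr.radius ℓ.2 (z + w) = Kerr.radius ℓ.2 (z' + w) := fun w ↦ by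
    rw [hzz' w, hradd]
  have hfdradT : ∀ w : E4, fderiv ℝ (Kerr.radius ℓ.2) (z + w) =
      fderiv ℝ (Kerr.radius ℓ.2) (z' + w) := fun w ↦ by
    rw [hzz' w]
    exact OpensChart.fderiv_eq_of_forall_add_eq hradd _
  have hitbT : ∀ (j : ℕ) (w : E4), iteratedFDeriv ℝ j (Kerr.bilin ℓ.1 ℓ.2) (z + w) =
      iteratedFDeriv ℝ j (Kerr.bilin ℓ.1 ℓ.2) (z' + w) := fun j w ↦ by
    rw [hzz' w]
    exact stub_kerrBandHigherRegularityU_iteratedFDeriv_eq_of_forall_add_eq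
      (Kerr.bilin_add_time ℓ.1 ℓ.2 t) j _
  have hitrT : ∀ (j : ℕ) (w : E4), iteratedFDeriv ℝ j (Kerr.radius ℓ.2) (z + w) =
      iteratedFDeriv ℝ j (Kerr.radius ℓ.2) (z' + w) := fun j w ↦ by
    rw [hzz' w]
    exact stub_kerrBandHigherRegularityU_iteratedFDeriv_eq_of_forall_add_eq hradd j _
  -- the two facts used along segments: lower radius bound and gradient bound in the tube
  have hstep : ∀ w : E4, ‖w‖ ≤ ρ₀ →
      r₁ ℓ < Kerr.radius ℓ.2 (z + w) ∧ ‖fderiv ℝ (Kerr.radius ℓ.2) (z + w)‖ ≤ max C₃ 0 := by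
    intro w hw
    refine ⟨?_, ?_⟩
    · rw [hradT]
      exact hTr₁ (ℓ, z' + w) (hmemT' w hw)
    · rw [hfdradT]
      have h := hC₃ (ℓ, z' + w) (hmemT' w hw)
      rw [norm_norm] at h
      exact h.trans (le_max_left _ _)
  intro w hw
  obtain ⟨hr, hdr⟩ := hstep w hw
  have hpos : 0 < Kerr.radius ℓ.2 (z + w) := (hr₁0 ℓ hℓ).trans hr
  refine ⟨hr, ?_, Kerr.contDiffAt_bilin ℓ.1 ℓ.2 hpos, Kerr.contDiffAt_radius hpos, ?_, ?_⟩
  · -- mean value inequality on the convex closed ball `closedBall z ρ₀ ⊆` tube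
    have hball : ∀ x ∈ Metric.closedBall z ρ₀, ‖x - z‖ ≤ ρ₀ := fun x hx ↦ by
      rwa [Metric.mem_closedBall, dist_eq_norm] at hx
    have hmvt := Convex.norm_image_sub_le_of_norm_fderiv_le (𝕜 := ℝ) (f := Kerr.radius ℓ.2)
      (s := Metric.closedBall z ρ₀) (C := max C₃ 0) (x := z) (y := z + w)
      (fun x hx ↦ by
        have h := (hstep (x - z) (hball x hx)).1
        rw [add_sub_cancel] at h
        exact (Kerr.contDiffAt_radius ((hr₁0 ℓ hℓ).trans h) (n := 1)).differentiableAt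
          one_ne_zero)
      (fun x hx ↦ by
        have h := (hstep (x - z) (hball x hx)).2
        rwa [add_sub_cancel] at h)
      (convex_closedBall z ρ₀) (Metric.mem_closedBall_self hρ₀.le)
      (by rwa [Metric.mem_closedBall, dist_eq_norm, add_sub_cancel_left])
    rwa [Real.norm_eq_abs, add_sub_cancel_left] at hmvt
  · rw [hfdradT]
    exact hνT (ℓ, z' + w) (hmemT' w hw)
  · intro j hj
    rw [hitbT, hitrT]
    exact hΦle (ℓ, z' + w) (hmemT' w hw) j hj

end Summit.FinalStateConjecture.FinalStateConjecture.Theorems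

end
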